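import Mathlib
import HarnessLib
import HarnessLib.Audit
import Summits.SmoothPoincare4.Statement
import Literature.Topology.FourManifolds.HomotopySpheres
import Literature.Topology.FourManifolds.Morse
import Literature.Topology.FourManifolds.HomotopyS4CompactProofs
import Literature.Topology.FourManifolds.HomotopyS4OrientableProofs
import HarnessLib.Audit.Status.Attr

/-!
Route: InvertibleGscPropertyR

# Route InvertibleGscPropertyR — Invert, unhandle, untie — SPC4 from invertibility, Poénaru GSC and
weak generalised Property R

It suffices to show three statements about a smooth homotopy 4-sphere Σ, each a consequence of SPC4,
none known to give it alone
(types the blind-wave sketch `invertible-gsc-property-r`, reader PASS 2026-08-17): (S1 =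
`PuncturedEmbeds`, the proposition of item
stmt-SmoothPoincare4-0371, `Iff.rfl`) every puncture Σ ∖ {p} smoothly embeds in ℝ⁴ — Σ is invertible
under #, Σ° is a Schoenflies ball;
(G = `SchoenfliesBallsGSC`, the ONE NEW crux) if all punctures of Σ embed in ℝ⁴ then Σ carries a
Morse function without index-1 critical
points — Poénaru's "all smooth 4-dimensional Schoenflies balls are geometrically simply connected"
in closed, boundary-free form;
(W = `GscStandard`, the proposition of item stmt-SmoothPoincare4-0377 by `Iff.rfl`, declared
RESIDUAL) a homotopy 4-sphere with a Morse function without index-1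
critical points is S⁴ — weak generalised Property R (GST Prop. 9.2). X = S1 ∧ G ∧ W; the attacked
conjunct is S1 ∧ G (together:
Kirby 4.18 for homotopy spheres, derived instead of assumed); W is the imported complement.
Lean: `Summit.SmoothPoincare4.SmoothPoincare4.Theses.SchoenfliesSplit.SchsplitPuncturedEmbeds ∧ (∀ S
: Literature.Topology.FourManifolds.HomotopySphere 4, (∀ p : S.carrier, ∃ f : (⟨{p}ᶜ,
isOpen_compl_singleton⟩ : TopologicalSpace.Opens S.carrier) → EuclideanSpace ℝ (Fin 4),
Manifold.IsSmoothEmbedding (𝓡 4) (𝓡 4) ((⊤ : ℕ∞) : WithTop ℕ∞) f) → ∃ f : S.carrier → ℝ,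
Literature.Topology.FourManifolds.IsMorse (𝓡 4) f ∧
Literature.Topology.FourManifolds.criticalSetOfIndex (𝓡 4) f 1 = ∅) ∧
Summit.SmoothPoincare4.SmoothPoincare4.Theses.NoOneHandles.NoohGscStandard`

## Assembly
Pure logic plus two landed Literature theorems, certified in `glue.lean` (`closes : PuncturedEmbeds
→ SchoenfliesBallsGSC → GscStandard →
SmoothPoincare4`, all three binders consumed; Sketch.lean rc 0, 0 sorries, axioms
propext/choice/Quot.sound): given M ≃ₕ S⁴ with an
atlas, M is compact
(`Literature.Topology.FourManifolds.compactSpace_of_homotopyEquiv_sphere_four_holds`) and orientable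
(`isOrientable_of_homotopyEquiv_sphere_four_holds`); bundle S : HomotopySphere 4 := ⟨M, o, ⟨e⟩⟩; S1
at S gives the punctured embeddings, G
turns them into a Morse function without index 1, W returns the diffeomorphism. No separate Assembly
item is filed (BC6: every declared
item is a consumed binder of `closes`). Conjunct split: S1 ∧ G ∧ W ⟺ SPC4 (each binder is S-implied;
per-piece probes Xᵢ → S fail 3/3);
attacked conjunct S1 ∧ G, residual GscStandard.

Rationale: WHY THIS LINE. Mechanism: embed the punctured sphere in S⁴ and use the AMBIENT standard ℝ⁴ structure
to remove 1-handles — S1 puts Σ° = Σ ∖ D̊ inside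
S⁴ as a Schoenflies ball, Mazur gives int Σ° ≅ ℝ⁴_std (Surveys in Geometry I ch. 7 p. 253;
arXiv:1609.05094 p. 2), Poénaru's
infinite-collapse / exterior-disc machine (Theorem 7.1.1 = arXiv Thm 1, 77 pp., published 2022,
never independently verified) is
claimed to turn exactly that into a handle decomposition of Σ° without 1-handles, hence of Σ = Σ° ∪
h⁴, and W (GST 2010 Conj. 4 /
Prop. 9.2, arXiv:1103.1601 p. 20) standardises 1-handle-free homotopy spheres. Imported areas:
exotic-ℝ⁴ end theory (Mazur, Kirby LNM
1374 XIV), 5-dimensional doubling (Gabai–Naylor–Schwartz arXiv:2307.06388 Thm 4.3/5.5, Q5.4/5.6 —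
the rungs and open questions S1 comes
from), Smale-style geometric simple connectivity, 3-manifold R-link surgery. What it does that the
hub's routes do not: NoOneHandles
ASSUMES Kirby 4.18|Σ (stmt-0378, no tool) — here it is DERIVED as S1 ∧ G with a 77-page claimed
proof attached to G; SchoenfliesSplit
needs the full Schoenflies conjecture + Cerf (stmt-11868) downstream of S1 — here that is replaced
by the weaker-looking G ∧ W with
disjoint toolboxes; no route or Literature file cites Poénaru's theorem (tree grep: only the closed
autopsy card
poenaru-exterior-discs-audit, graded known, which asked for exactly this filing). Negatives index:
empty.

RANKED CRUXES. #2 PuncturedEmbeds (crux) — (S1, face (e)/(d) of the sketch's equivalence web; the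
SAME proposition as SchoenfliesSplit crux A = stmt-SmoothPoincare4-0371 — `Iff.rfl` in Sketch.lean
§2 — re-spelled without the `ContDiff`-scoped notation `∞`, which route files rendered after
2026-08-15 no longer open; operator alias/merge with 0371 requested) for every smooth homotopy
4-sphere Σ and every point p, the puncture Σ ∖ {p} smoothly embeds in ℝ⁴ — equivalently Σ is
invertible in the connected-sum monoid θ₄, Σ° is a Schoenflies ball, Σ°×I ≅ B⁵, Σ # Σ̄ ≅ S⁴ (GNS
Question 5.6 asks it for Gluck twists). [difficulty: open-problem] (why it might fail: a
non-invertible exotic S⁴, i.e. some Σ ∖ {p} that is a SMALL exotic ℝ⁴ with a smoothly S³-collared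
end (large ones are excluded by Donaldson/Taubes, Kirby LNM 1374 XIV Rem. 2); no tool addresses
arbitrary Σ (GNS handle only δ = 1 ribbon hemispheres).) [arXiv:2307.06388,
doi:10.1016/j.aim.2025.110455, KervaireMilnorAnnals1963, arXiv:2212.02004, Kirby1989]
#3 SchoenfliesBallsGSC (crux) — (G, NEW; Poénaru's Theorem 1 / Surveys in Geometry I Thm 7.1.1 in
closed boundary-free per-Σ form) for every smooth homotopy 4-sphere Σ: if every puncture Σ ∖ {p}
smoothly embeds in ℝ⁴, then Σ admits a Morse function with no critical points of index 1 (Σ is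
geometrically simply connected: a handle decomposition without 1-handles). Route-internal proof plan
(birth skeleton): Mazur (Σ ∖ {p} ≅ ℝ⁴_std, KNOWN) + Poénaru's exterior-disc Lemma 3 and RED/BLUE
infinite collapses (OPEN: claimed, unverified). [deps: PuncturedEmbeds] [difficulty: XL] (why it
might fail: Poénaru's 77-page proof is unrefereed in substance (infinite processes; Lemma 3 lets
discs acquire holes and provisionally ADD 1-handles); an invertible exotic S⁴ all of whose handle
decompositions need 1-handles (AK/Gompf-type balls, Kirby 4.18) kills it.) [arXiv:1609.05094,
doi:10.1007/978-3-030-86695-2_7, doi:10.4171/emss/73, Kirby1997,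
lit:book:editornd-surveys-geometry-i]
#4 GscStandard (crux) — (W, RESIDUAL — the imported complement; the SAME proposition as NoOneHandles
crux C2 = stmt-SmoothPoincare4-0377 (also MinimalSphereMeanConvex.GscStandard) — `Iff.rfl` in
Sketch.lean §2 — re-spelled with `Diffeomorph … ((⊤ : ℕ∞) : WithTop ℕ∞)` for the scoped `≃ₘ⟮𝓡 4, 𝓡
4⟯`; operator alias/merge with 0377 requested) every smooth homotopy 4-sphere carrying a Morse
function without index-1 critical points is diffeomorphic to S⁴ — the weak generalised Property R
conjecture (distant unlink + cancelling Hopf pairs allowed), equivalent to SPC4 for 1-handle-free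
homotopy spheres by GST Prop. 9.2; n = 1 two-handles is Gabai's Property R (tree:
PropertyRTraceClosing). [difficulty: open-problem] (why it might fail: = SPC4 restricted to
1-handle-free homotopy spheres; only n ≤ 1 two-handles known (Gabai) plus special 2-component
families (Meier–Zupan); one R-link not slide+Hopf-pair equivalent to the unlink (GST L_{n,k}?) is a
g.s.c. exotic S⁴.) [GompfScharlemannThompson2010, arXiv:1103.1601, Gabai1987, MeierZupan2022,
doi:10.4171/cmh/131]

TWO-LAYER PLAN. Foreseen glued splits once work starts (none filed now; each is the registered birth
skeleton of the node, ≤ 3 children):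
SchoenfliesBallsGSC ⇐ Mazur (Σ∖{p} ↪ ℝ⁴ ⇒ Σ∖{p} ≅ ℝ⁴, KNOWN) → Poenaru (all punctures ≅ ℝ⁴ ⇒ Morse
function without index 1, OPEN) → G;
PuncturedEmbeds ⇐ Invertible (∀ Σ ∃ T, Σ # T ≅ S⁴ = SchoenfliesSplit's support item stmt-0373, OPEN)
→ AllPuncturesOfUnit (a unit of the
monoid has all punctures embedded, KNOWN) → S1; GscStandard ⇐ RLinkSphereOfNoIndexOne (handle
reading, KNOWN) → WeakGPR (every R-link
sphere Σ_L is S⁴, OPEN) → W — the last only if NoOneHandles' tenure does not split 0377 first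
(shared node, one active decomposition).

KILL CRITERIA. ¬PuncturedEmbeds (a non-invertible exotic S⁴) refutes SPC4 itself — route and summit
die together (close refuted:PuncturedEmbeds).
¬SchoenfliesBallsGSC (an invertible exotic S⁴ needing 1-handles, or a located fatal gap in Poénaru
§§4–7 with a counterexample to his Lemma-3
output) closes THIS route (close refuted:SchoenfliesBallsGSC) and sends S1 back to
SchoenfliesSplit's Schoenflies+Cerf assembly; a
located gap WITHOUT counterexample is not a refutation — G stays open, difficulty re-rated.
¬GscStandard (a g.s.c. exotic S⁴) refutes SPC4.
Mooted if NoOneHandles closes both its cruxes (0377 + 0378) or SchoenfliesSplit closes (S1 +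
Schoenflies + Cerf): SPC4 is then proved.

NOT DECOMPOSED YET. The Mazur step (Schoenflies ball interior standard; collar shrinking Σ∖{p} ≅
int(Σ∖D̊)), the handle ↔ Morse dictionary (no 1-handles ⟺
criticalSetOfIndex f 1 = ∅ after rearrangement), the identification "image of Σ∖D̊ is the closure of
a complementary domain of a smooth
S³ ⊂ S⁴", Poénaru's finite core (Lemma 3: exterior cancelling discs in the collar ⇒ GSC) and the
two-collar statement INHERIT are all
layer-2 material inside the registered skeletons (stubs), not items. Faces (b)/(c) of the S1 web
(Σ#Σ̄ ≅ S⁴, Σ°×I ≅ B⁵) and the GNS rungs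
(undisking number one) need manifolds with boundary / ribbon-disc notions the tree lacks — kept as
cited lines, not typed.

CHEAPEST FALSIFIER. Refereeing: locate the gap (or certify the skeleton) of Poénaru's proof,
arXiv:1609.05094 §§4–7 (the disjointness/finiteness of the final
exterior-disc family after infinitely many colour changes; whether "cancelling position" presupposes
boundary-parallel 1-handles) — a
desk check, either outcome informative; I read the published survey version (Surveys in Geometry I
ch. 7, printed pp. 269–273 = lit key book:editornd-surveys-geometry-i page files
p0253–p0256: Thm 7.1.1 and "only int Δ ≅ ℝ⁴ is used" on p0253/p0254 [printed p. 270]; GSC ⇒ B⁴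
explicitly NOT claimed, p0256 [printed p. 272]) and found no erratum, review locating a gap, or
citing refutation in the held corpus
(queries in Novelty); galaxy was saturated this session (3 × "queued too long", 1 × HTTP 403 on
read). Mathematically cheapest: run
Poénaru's machine on the Akbulut–Kirby/Gompf Schoenflies balls Δ_{P_n} (n = 3): an output is
AC-independent 1-handle removal (striking),
a failure locates the gap.

NUMBERS. Θₙ / invertibility: every homotopy n-sphere is invertible for n ≠ 4 (Kervaire–Milnor 1963
Thm 1.1; tree named fact
`Literature.Topology.FourManifolds.exists_commGroup_homotopySphereClass_of_ne_three`, n ≠ 0, 3, 4);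
bP / exotic 7-spheres: 28 classes, all
twisted, all carrying 2-critical-point Morse functions (Milnor 1956 §2 (C)); weak GPR known for n =
1 two-handles (Gabai 1987) and GST's
L_{n,1} / generalised square knots (Meier–Zupan 2022); GNS 2025: Σ_S° × I ≅ B⁵ and Σ_S Schoenflies
ball for 2-knots with a δ = 1 ribbon
hemisphere (Thm 1.1/4.3/5.5), first open rung fusion number one (Q5.4).

DEFINITION REQUESTS. None needed for the typed items (all over `HomotopySphere 4`, `IsMorse`,
`criticalSetOfIndex`, `Manifold.IsSmoothEmbedding`, `Opens`).
Wanted later for the layer-2 stubs / rungs, not now: `IsSchoenfliesBall` (closure of a complementary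
domain of a smooth S³ ⊂ S⁴),
`IsGSC` for compact 4-manifolds with boundary (proper Morse function without index 1 — the tree's
`IsMorse` is boundary-free), ribbon-disc
undisking/fusion number (GNS). Cite facts wanted (T0 lane): Mazur 1959/61 "int Δ_Schoenflies ≅ ℝ⁴
(DIFF)" [Surveys in Geometry I p. 253];
Milnor 1956 Construction (C) two-critical-point Morse functions on twisted spheres.

Novelty: Searches (2026-08-17): tree grep "poenaru|Schoenflies ball|1609.05094" over Summits/SmoothPoincare4
+ Literature (0 route/Literature cites of the theorem; 1 closed card poenaru-exterior-discs-audit =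
known, asking for this filing); `lean search 'criticalSetOfIndex (𝓡 4) _ 1 = ∅'` (80 hits:
NoOneHandles, MinimalSphereMeanConvex, ConvexBisection/AcyclicBisectionRigidity GSC lever (Stein
bisections), SymplecticOrigami/OrigamiFoldExistence, PresentationSpheresStandard — none with a
punctured-embedding hypothesis); `lit search --hybrid "Schoenflies balls geometrically simply
connected Poenaru"` (10 docs; hit 10 = book:editornd-surveys-geometry-i = the published chapter,
READ pp. 253–256); `lit search --hybrid "Whitehead nightmare geometrically simply connected"` (6
generic); `lit vsearch "generalized Property R … Andrews–Curtis … Hopf pairs"` (8 generic); `lit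
read arxiv:1103.1601 --grep` (Prop 9.2 p. 20, Conj. 4 p. 19, AC invariant p. 17); `lit read
arxiv:2307.06388` (Thm 4.3 p. 11, Thm 5.5/Q5.4/Q5.6 p. 13); `lit read arxiv:1609.05094` (Thm 1/2 p.
2, status p. 3); `lit galaxy search "geometrically simply connected|…" --star pdf` (2 hits:
pdf:6632379436839298680 Topology Appl. offprint (read → HTTP 403), pdf:1275633640 irrelevant); `lit
galaxy search … --star all` ×3 ("queued too long", saturated); `ledger negatives --problem
SmoothPoincare4` (0); `ledger idea list` (no invertible/gsc card besides the closed audit card and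
minimal-s3-mean-convex-gsc).
Nearest prior art found: doi:  [refs: 10.1007/978-3-030-86695-2_7, 1103.1601, 2307.06388, 1609.05094, book:editornd-surveys-geometry-i, arxiv:1103.1601, arxiv:2307.06388, arxiv:1609.05094, doi:10.1007/978-3-030-86695-2_7]

Barriers (technique_class: GSC infinite collapse, Mazur swindle, doubling, R-links): - technique_class: GSC infinite collapse, Mazur swindle, doubling, R-links
- Literature.Barriers.SmoothPoincare4.OpenAnalogueBarrierFour: (A14, kills "Σ∖{p} embeds in ℝ⁴ /
open ℝ⁴-homeomorph ⇒ standard") PuncturedEmbeds only ASSERTS the embedding (an S-consequence) and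
never infers standardness from it; the Mazur stub inside G's skeleton concludes Σ∖{p} ≅ ℝ⁴ from the
COMPACT closure Σ (a smoothly S³-collared end, i.e. a Schoenflies ball in S⁴) — exactly the
hypothesis DeMichelis–Freedman opens lack; outside.
- Literature.Barriers.SmoothPoincare4.StrictPropertyTwoRBarrier: (A16, conditional no-go for SPC4
via STRICT generalised Property R) GscStandard = NoOneHandles C2 = the WEAK conjecture with
cancelling Hopf pairs, which the catalogue itself lists as the escape ("C2 safe"); G produces
1-handle-free decompositions and makes no slide-triviality claim; outside. Residual anyway.
- Literature.Barriers.SmoothPoincare4.TwistedSphereBarrierFour: (A6) no clutching construction is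
used; it is why the BC5 rungs live in dimension 7 / ≥ 5 (twisted 4-spheres are inside S's known
regime); not engaged.
- Literature.Barriers.SmoothPoincare4.ContractibleBarrierFour: (A12, with
RelativeContractibleBarrierFour) G concerns homotopy 4-BALLS with S³ boundary sitting in S⁴
(Casson's non-GSC contractible manifolds have ∂ ≠ S³, doi:10.4171/emss/73 §5); no homeo ⇒ diffeo or
boundary-extension argument for general contractible manifolds is made; outside.
- Literature.Barriers.SmoothPoincare4.HCobordis

sub-problem: SmoothPoincare4 · status: open · opened planner-type-ae233cf647-0 2026-08-17T18:36:44Z · rev 0 · ledger route-SmoothPoincare4-InvertibleGscPropertyR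
GENERATED by the gate from the ledger (D-0016/17). Provers cite these decls: `theorem foo : Summit.SmoothPoincare4.SmoothPoincare4.Theses.InvertibleGscPropertyR.<Decl> := …` in Summits/SmoothPoincare4/SmoothPoincare4/Theorems/<Name>.lean.
-/

namespace Summit.SmoothPoincare4.SmoothPoincare4.Theses.InvertibleGscPropertyR

open scoped BigOperators Topology Manifold Classical MeasureTheory ProbabilityTheory Matrix InnerProductSpace ComplexConjugate ContinuousMap
open Filter Set Function TopologicalSpace MeasureTheory

attribute [summit_statement] _root_.SmoothPoincare4

open Literature.SPC4

/-- item stmt-SmoothPoincare4-19422 · crux · rank 2 · open · by planner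
why it might fail: a non-invertible exotic S⁴, i.e. some Σ ∖ {p} that is a SMALL exotic ℝ⁴ with a smoothly S³-collared end (large ones are excluded by Donaldson/Taubes, Kirby LNM 1374 XIV Rem. 2); no tool addresses arbitrary Σ (GNS handle only δ = 1 ribbon hemispheres).
sources: arXiv:2307.06388, doi:10.1016/j.aim.2025.110455, KervaireMilnorAnnals1963, arXiv:2212.02004, Kirby1989
[crux] (S1, face (e)/(d) of the sketch's equivalence web; the SAME proposition as SchoenfliesSplit
crux A = stmt-SmoothPoincare4-0371 — `Iff.rfl` in Sketch.lean §2 — re-spelled without the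
`ContDiff`-scoped notation `∞`, which route files rendered after 2026-08-15 no longer open; operator
alias/merge with 0371 requested) for every smooth homotopy 4-sphere Σ and every point p, the
puncture Σ ∖ {p} smoothly embeds in ℝ⁴ — equivalently Σ is invertible in the connected-sum monoid
θ₄, Σ° is a Schoenflies ball, Σ°×I ≅ B⁵, Σ # Σ̄ ≅ S⁴ (GNS Question 5.6 asks it for Gluck twists).
[difficulty: open-problem] -/
@[route_item "route-SmoothPoincare4-InvertibleGscPropertyR", crux]
def PuncturedEmbeds : Prop :=
  ∀ (S : Literature.Topology.FourManifolds.HomotopySphere 4) (p : S.carrier), ∃ f : (⟨{p}ᶜ, isOpen_compl_singleton⟩ : TopologicalSpace.Opens S.carrier) → EuclideanSpace ℝ (Fin 4), Manifold.IsSmoothEmbedding (𝓡 4) (𝓡 4) ((⊤ : ℕ∞) : WithTop ℕ∞) f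

/-- item stmt-SmoothPoincare4-19423 · crux · rank 3 · open · by planner
why it might fail: Poénaru's 77-page proof is unrefereed in substance (infinite processes; Lemma 3 lets discs acquire holes and provisionally ADD 1-handles); an invertible exotic S⁴ all of whose handle decompositions need 1-handles (AK/Gompf-type balls, Kirby 4.18) kills it.
sources: arXiv:1609.05094, doi:10.1007/978-3-030-86695-2_7, doi:10.4171/emss/73, Kirby1997, lit:book:editornd-surveys-geometry-i
[crux] (G, NEW; Poénaru's Theorem 1 / Surveys in Geometry I Thm 7.1.1 in closed boundary-free per-Σ
form) for every smooth homotopy 4-sphere Σ: if every puncture Σ ∖ {p} smoothly embeds in ℝ⁴, then Σ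
admits a Morse function with no critical points of index 1 (Σ is geometrically simply connected: a
handle decomposition without 1-handles). Route-internal proof plan (birth skeleton): Mazur (Σ ∖ {p}
≅ ℝ⁴_std, KNOWN) + Poénaru's exterior-disc Lemma 3 and RED/BLUE infinite collapses (OPEN: claimed,
unverified). [deps: PuncturedEmbeds] [difficulty: XL] -/
@[route_item "route-SmoothPoincare4-InvertibleGscPropertyR", crux]
def SchoenfliesBallsGSC : Prop :=
  ∀ S : Literature.Topology.FourManifolds.HomotopySphere 4, (∀ p : S.carrier, ∃ f : (⟨{p}ᶜ, isOpen_compl_singleton⟩ : TopologicalSpace.Opens S.carrier) → EuclideanSpace ℝ (Fin 4), Manifold.IsSmoothEmbedding (𝓡 4) (𝓡 4) ((⊤ : ℕ∞) : WithTop ℕ∞) f) → ∃ f : S.carrier → ℝ, Literature.Topology.FourManifolds.IsMorse (𝓡 4) f ∧ Literature.Topology.FourManifolds.criticalSetOfIndex (𝓡 4) f 1 = ∅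

/-- item stmt-SmoothPoincare4-19424 · crux · rank 4 · open · by planner
why it might fail: = SPC4 restricted to 1-handle-free homotopy spheres; only n ≤ 1 two-handles known (Gabai) plus special 2-component families (Meier–Zupan); one R-link not slide+Hopf-pair equivalent to the unlink (GST L_{n,k}?) is a g.s.c. exotic S⁴.
sources: GompfScharlemannThompson2010, arXiv:1103.1601, Gabai1987, MeierZupan2022, doi:10.4171/cmh/131
[crux] (W, RESIDUAL — the imported complement; the SAME proposition as NoOneHandles crux C2 =
stmt-SmoothPoincare4-0377 (also MinimalSphereMeanConvex.GscStandard) — `Iff.rfl` in Sketch.lean §2 —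
re-spelled with `Diffeomorph … ((⊤ : ℕ∞) : WithTop ℕ∞)` for the scoped `≃ₘ⟮𝓡 4, 𝓡 4⟯`; operator
alias/merge with 0377 requested) every smooth homotopy 4-sphere carrying a Morse function without
index-1 critical points is diffeomorphic to S⁴ — the weak generalised Property R conjecture (distant
unlink + cancelling Hopf pairs allowed), equivalent to SPC4 for 1-handle-free homotopy spheres by
GST Prop. 9.2; n = 1 two-handles is Gabai's Property R (tree: PropertyRTraceClosing). [difficulty:
open-problem] -/
@[route_item "route-SmoothPoincare4-InvertibleGscPropertyR", crux]
def GscStandard : Prop :=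
  ∀ (S : Literature.Topology.FourManifolds.HomotopySphere 4) (f : S.carrier → ℝ), Literature.Topology.FourManifolds.IsMorse (𝓡 4) f → Literature.Topology.FourManifolds.criticalSetOfIndex (𝓡 4) f 1 = ∅ → Nonempty (Diffeomorph (𝓡 4) (𝓡 4) S.carrier (Metric.sphere (0 : EuclideanSpace ℝ (Fin 5)) 1) ((⊤ : ℕ∞) : WithTop ℕ∞))

/-- item stmt-SmoothPoincare4-19425 · assembly · rank 1 · open · by planner
sources: Literature.Topology.FourManifolds.compactSpace_of_homotopyEquiv_sphere_four_holds, Literature.Topology.FourManifolds.isOrientable_of_homotopyEquiv_sphere_four_holds, arXiv:1609.05094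
[assembly] PuncturedEmbeds → SchoenfliesBallsGSC → GscStandard → SPC4 (pure logic plus compactness
and orientability of a manifold homotopy equivalent to S⁴; recipe = the certified `closes`: intro M
_ _ _ _ _ e; haveI := compactSpace_of_homotopyEquiv_sphere_four_holds M e; obtain ⟨o⟩ :=
isOrientable_of_homotopyEquiv_sphere_four_holds M e; obtain ⟨f, hf, h1⟩ := hG ⟨M, o, ⟨e⟩⟩ (hS1 ⟨M,
o, ⟨e⟩⟩); exact hW ⟨M, o, ⟨e⟩⟩ f hf h1). -/
@[route_item "route-SmoothPoincare4-InvertibleGscPropertyR"]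
def Assembly : Prop :=
  PuncturedEmbeds → SchoenfliesBallsGSC → GscStandard → _root_.SmoothPoincare4

/-! D-0027 §2.1 — DECIDING THEOREM (planner-authored via `route open/edit --closes-file`; by planner-type-ae233cf647-0 2026-08-17T18:36:44Z):
its hypotheses are this route's items and its conclusion the sub-problem Statement (glue_lint), and it elaborates with this file. -/

@[closes "route-SmoothPoincare4-InvertibleGscPropertyR"] theorem closes (hS1 : PuncturedEmbeds) (hG : SchoenfliesBallsGSC) (hW : GscStandard) : _root_.SmoothPoincare4 := by
  intro M _ _ _ _ _ e
  haveI : CompactSpace M :=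
    Literature.Topology.FourManifolds.compactSpace_of_homotopyEquiv_sphere_four_holds M e
  obtain ⟨o⟩ :=
    Literature.Topology.FourManifolds.isOrientable_of_homotopyEquiv_sphere_four_holds M e
  obtain ⟨f, hf, h1⟩ := hG ⟨M, o, ⟨e⟩⟩ (hS1 ⟨M, o, ⟨e⟩⟩)
  exact hW ⟨M, o, ⟨e⟩⟩ f hf h1

end Summit.SmoothPoincare4.SmoothPoincare4.Theses.InvertibleGscPropertyR
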